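import Literature.Probability.Percolation.ArmSeparationExtSlotEvents
import Literature.Probability.Percolation.ArmSeparationExtSlotArith
import Literature.Probability.Percolation.ArmSeparationExtSectors
import HarnessLib

/-!
# Outer slots: where the pieces of the two corridors are, pair by pair

Topic: Probability / Percolation; family `crit-perc`. A brick of the discharge of
`Literature.Probability.Percolation.Nolin2008_twoArm_separation` (Nolin 2008, Thm. 11
[arXiv 0711.4948: Thm. 10]; `ArmSeparation.lean`), landing of the EXTERNAL extremities — the
generic geometry behind the disjointness of the private supports of the two colours (Nolin's
Lemma 13 [arXiv Lemma 12]), mirror of the pair lemmas of `ArmSeparationSlotSep.lean` for the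
rotated frames `ρ^i`:

* the rotations carry frame coordinates to the sector coordinates (`dep_rot`, `lat_rot`,
  `rot_mem_sectorNear_iff`);
* the near set of a tip (`enearSet`: `ρ^i` of the slot frame box and of the spoke's box), its frame
  coordinates and norm (`exists_of_mem_enearSet`, `norm_of_mem_enearSet`), and its sector
  (`enearSet_subset_rotNear`);
* near sets of tips in the same frame with separated rows are disjoint
  (`enearSet_disjoint_enearSet_same`);
* a ring tube off the window misses the rotated spoke (`ringTube_disjoint_rotSpoke`: other sides by
  the sectors, the same side by the lateral coordinate, the diagonal frames `2`, `5` touching four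
  chunks);
* a reflected ring tube of the side `3` off its window misses the approach strip
  (`neg_ringTube_disjoint_strip`), and reflected tubes of the other sides too (sectors).

## References

* P. Nolin, *Near-critical percolation in two dimensions*, Electron. J. Probab. 13 (2008), §4.3
  Lemma 13 (disjoint supports `𝒜^±`), §4.4 [arXiv 0711.4948: Lemma 12, Thm. 10]. [Nolin2008]
-/

noncomputable section

open Set

namespace Literature.Probability.Percolation

open LatticeModels Tube

/-! ### Sector coordinates of rotated points -/

/-- The depth coordinate of a rotated point is its first frame coordinate (`i < 6`). [folklore] -/
theorem dep_rot {i : ℕ} (hi : i < 6) (u : Site 2) : dep i (triRotIsoPow i u) = u 0 := by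
  obtain ⟨a0, a1, b0, b1, c0, c1, d0, d1, e0, e1, f0, f1⟩ := rot_apply_formula u
  interval_cases i <;> simp only [dep] <;> omega

/-- The lateral coordinate of a rotated point: the second frame coordinate, except in the diagonal
frames `2`, `5` where it is `-(u₀ + u₁)` (`i < 6`). [folklore] -/
theorem lat_rot {i : ℕ} (hi : i < 6) (u : Site 2) : lat i (triRotIsoPow i u) = if i % 3 = 2 then -(u 0 + u 1) else u 1 := by
  obtain ⟨a0, a1, b0, b1, c0, c1, d0, d1, e0, e1, f0, f1⟩ := rot_apply_formula u
  interval_cases i <;> simp only [lat, Nat.reduceMod, if_true, if_false, show (1 : ℕ) ≠ 2 from by decide,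
    show (0 : ℕ) ≠ 2 from by decide] <;> omega

/-- **The rotations carry the sector of the side `x₀ = 2M` to the `i`-th sector**: `ρ^i u` lies in
`sectorNear i λ` iff `u₁ ≤ -λ` and `λ ≤ u₀ + u₁` (`i < 6`; the same condition in all frames). [folklore] -/
theorem rot_mem_sectorNear_iff {i : ℕ} (hi : i < 6) {lam : ℤ} {u : Site 2} :
    triRotIsoPow i u ∈ sectorNear i lam ↔ u 1 ≤ -lam ∧ lam ≤ u 0 + u 1 := by
  rw [mem_sectorNear_iff_of_lt hi, lat_rot hi, dep_rot hi]
  by_cases h : i % 3 = 2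
  · rw [if_pos h]; constructor <;> rintro ⟨h1, h2⟩ <;> constructor <;> omega
  · rw [if_neg h]

/-! ### The near set of a tip -/

/-- **The near set of a tip of the frame `i`**: `ρ^i` of its slot frame box and of its spoke's box. [cite: Nolin2008, §4.3 Lemma 13 (arXiv 0711.4948: Lemma 12, the sets `𝒜^±`)] -/
def enearSet (i M k : ℕ) (T₀ : ℤ) (w w' L ε : ℕ) : Set (Site 2) :=
  triRotIsoPow i '' (↑(eslotFrame M k T₀ w) ∪ (extSpokeTube M k T₀ w' L ε).box)

/-- Frame coordinates of a point of the near set (`1 ≤ w`, `k + 1 ≤ L`, `w ≤ w'`,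
`w' + k/4 + 2ε ≤ k`). [folklore] -/
theorem exists_of_mem_enearSet {i M k : ℕ} {T₀ : ℤ} {w w' L ε : ℕ} (hw : 1 ≤ w) (hL : k + 1 ≤ L) (hww : w ≤ w')
    (hfit : (w' : ℤ) + (k / 4 : ℕ) + 2 * ε ≤ k) {v : Site 2} (hv : v ∈ enearSet i M k T₀ w w' L ε) :
    ∃ u, triRotIsoPow i u = v ∧ 2 * (M : ℤ) + 1 ≤ u 0 ∧ u 0 ≤ 2 * (M : ℤ) + k + L ∧ T₀ + 1 ≤ u 1 ∧ u 1 ≤ T₀ + w + 2 * k := by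
  obtain ⟨u, hu, rfl⟩ := hv
  refine ⟨u, rfl, ?_⟩
  rcases hu with hu | hu
  · rw [Finset.mem_coe, mem_eslotFrame hw] at hu; omega
  · rw [Tube.mem_box] at hu
    simp only [extSpokeTube] at hu
    have hk4 : ((k / 4 : ℕ) : ℤ) ≥ 0 := by positivity
    omega

/-- **The norm of a point of the near set is its frame depth** (`u₀`): between `2M + 1` and
`2M + k + L` (`R₀`-type margins: `T₀ + w + 2k ≤ 0`, `-2M ≤ T₀`). [folklore] -/
theorem norm_rot_eq (i : ℕ) {M : ℕ} {u : Site 2} (h0 : 2 * (M : ℤ) + 1 ≤ u 0) (h1 : -(2 * (M : ℤ)) ≤ u 1) (h1' : u 1 ≤ 0) :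
    triNorm (triRotIsoPow i u) = u 0 := by
  rw [triNorm_rot]
  apply le_antisymm
  · exact triNorm_le_iff_lin.2 (by omega)
  · exact le_triNorm_iff_lin.2 (Or.inl le_rfl)

/-- The near set lies in the near sector `rotNear i M lam m₀` (`k + L ≤ lam`, `-2M + m₀ ≤ T₀ + 1`,
`T₀ + w + 2k ≤ -m₀`). [folklore] -/
theorem enearSet_subset_rotNear {i M k : ℕ} {T₀ : ℤ} {w w' L ε lam m₀ : ℕ} (hw : 1 ≤ w) (hL : k + 1 ≤ L) (hww : w ≤ w')
    (hfit : (w' : ℤ) + (k / 4 : ℕ) + 2 * ε ≤ k) (hlam : (k : ℤ) + L ≤ lam) (hlo : -(2 * (M : ℤ)) + m₀ ≤ T₀ + 1)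
    (hhi : T₀ + w + 2 * k ≤ -(m₀ : ℤ)) : enearSet i M k T₀ w w' L ε ⊆ rotNear i M lam m₀ := by
  intro v hv
  obtain ⟨u, rfl, h1, h2, h3, h4⟩ := exists_of_mem_enearSet hw hL hww hfit hv
  exact ⟨u, ⟨by omega, by omega, by omega, by omega⟩, rfl⟩

/-- **Near sets of two tips of the same frame with separated rows are disjoint.** [folklore] -/
theorem enearSet_disjoint_enearSet_same {i M k k' : ℕ} {T₀ T₀' : ℤ} {w w₁ w₂ L L' ε : ℕ} (hw : 1 ≤ w) (hL : k + 1 ≤ L) (hL' : k' + 1 ≤ L')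
    (hww₁ : w ≤ w₁) (hww₂ : w ≤ w₂) (hfit : (w₁ : ℤ) + (k / 4 : ℕ) + 2 * ε ≤ k) (hfit' : (w₂ : ℤ) + (k' / 4 : ℕ) + 2 * ε ≤ k')
    (hsep : T₀ + w + 2 * k < T₀' + 1) :
    Disjoint (enearSet i M k T₀ w w₁ L ε) (enearSet i M k' T₀' w w₂ L' ε) := by
  rw [Set.disjoint_left]
  intro v hv hv'
  obtain ⟨u, rfl, -, -, -, h4⟩ := exists_of_mem_enearSet hw hL hww₁ hfit hv
  obtain ⟨u', hu', -, -, h3', -⟩ := exists_of_mem_enearSet hw hL' hww₂ hfit' hv'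
  have : u' = u := (triRotIsoPow i).injective hu'
  subst this
  omega

/-! ### A ring tube off the window misses the rotated spoke -/

/-- The positions of the tubes of the side `i` with lateral index `ι` within `2` of `ιc` (or, on the
diagonal sides, within `[n - ιc - 2, n - ιc + 1]`) lie in the eight-tube window
`[blockOff n i + 2(ιc - 2), blockOff n i + 2(ιc - 2) + 7]`. [folklore] -/
theorem piecePos_mem_window {n i ι ιc : ℕ} (hι : ι < n) (h2 : 2 ≤ ιc) (hιc : ιc + 3 ≤ n)
    (hrange : if i % 3 = 2 then n - ιc - 2 ≤ ι ∧ ι ≤ n - ιc + 1 else ιc - 1 ≤ ι ∧ ι ≤ ιc + 1) :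
    blockOff n i + 2 * (ιc - 2) ≤ piecePos n i ι ∧ piecePos n i ι + 1 ≤ blockOff n i + 2 * (ιc - 2) + 7 := by
  by_cases h : i % 3 = 2
  · rw [if_pos h] at hrange; rw [piecePos_eq_of_two h]; omega
  · rw [if_neg h] at hrange; rw [piecePos_eq_of_ne h]; omega

/-- **A ring tube off the window misses the rotated spoke.** The ring of radius `r = n s` (`e` the
half-width, `2e ≤ r`), its `g`-th tube, `g` outside the window of the side `ic` about the lateral
index `ιc ≥ 2`; the spoke of the frame `ic` with rows `[ξ, ξ+2ε]` aligned in the chunk `ιc`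
(`-r + ιc s ≤ ξ`, `ξ + 2ε ≤ -r + (ιc+1) s`), starting at frame depth `≥ 2M + k` with
`2M + k + ξ ≥ lamS` … precisely: every spoke point `u` has `u₁ ≤ -lamS`, `lamS ≤ u₀ + u₁`, with
`2e < lamS`; and `3e < s`. [cite: Nolin2008, §4.3 Lemma 13 (arXiv 0711.4948: Lemma 12)] -/
theorem ringTube_disjoint_rotSpoke {r e s n g ic M k : ℕ} {T₀ : ℤ} {w' L ε ιc : ℕ} {lamS : ℤ}
    (hn : 1 ≤ n) (hns : n * s = r) (he : 2 * e ≤ r) (hg : g < 12 * n - 4) (hic : ic < 6) (h2 : 2 ≤ ιc) (hιn : ιc + 3 ≤ n)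
    (hout : g < blockOff n ic + 2 * (ιc - 2) ∨ blockOff n ic + 2 * (ιc - 2) + 7 < g)
    (hξ1 : -(r : ℤ) + ιc * s ≤ T₀ + w' + k + (k / 4 : ℕ)) (hξ2 : T₀ + w' + k + (k / 4 : ℕ) + 2 * ε ≤ -(r : ℤ) + (ιc + 1) * s)
    (hes : 3 * e < s) (hlam : 2 * (e : ℤ) < lamS)
    (hsec : ∀ u ∈ (extSpokeTube M k T₀ w' L ε).box, u 1 ≤ -lamS ∧ lamS ≤ u 0 + u 1)
    (hdep : ∀ u ∈ (extSpokeTube M k T₀ w' L ε).box, 2 * (M : ℤ) + 1 ≤ u 0 ∧ -(2 * (M : ℤ)) ≤ u 1 ∧ u 1 ≤ 0)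
    {v : Site 2} (hvT : v ∈ (ringTube r e s g).box) (hv : v ∈ triRotIsoPow ic '' (extSpokeTube M k T₀ w' L ε).box) : False := by
  have hs : 1 ≤ s := by omega
  have hr : n = r / s := by rw [← hns, Nat.mul_div_cancel _ hs]
  obtain ⟨u, hu, rfl⟩ := hv
  obtain ⟨hu1, hu2⟩ := hsec u hu
  obtain ⟨hd0, hd1, hd1'⟩ := hdep u hu
  have hub := (Tube.mem_box _).1 hu
  simp only [extSpokeTube, Nat.cast_mul, Nat.cast_ofNat] at hub
  have hnorm : triNorm (triRotIsoPow ic u) = u 0 := norm_rot_eq ic hd0 hd1 hd1'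
  subst hr
  have hg' : g < 12 * (r / s) - 4 := hg
  obtain ⟨hsecT, hlat1, hlat2, hn1, hn2⟩ := ringTube_bounds hn ⟨_, hns.symm.trans (mul_comm _ _)⟩ he hg' hvT
  rw [hnorm] at hn1 hn2
  set sd := ringSide r s g with hsd
  have hsd6 : sd < 6 := ringSide_lt r s g
  by_cases hside : sd = ic
  · -- same side: the lateral coordinate
    have hlat := lat_rot hic u
    rw [hside] at hlat1 hlat2
    rw [hlat] at hlat1 hlat2
    have hpos := pos_le_of_side_lat hn hg'
    rw [← hsd, hside] at hpos
    have hιlt : ringLat r s g < r / s := ringLat_lt hn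
    have hns' : ((r / s : ℕ) : ℤ) * s = r := by exact_mod_cast hns
    have hs0 : 0 < s := hs
    have he3 : (3 * e : ℤ) < s := by exact_mod_cast hes
    have he1 : (e : ℤ) < s := by linarith
    have hrange : if ic % 3 = 2 then r / s - ιc - 2 ≤ ringLat r s g ∧ ringLat r s g ≤ r / s - ιc + 1
        else ιc - 1 ≤ ringLat r s g ∧ ringLat r s g ≤ ιc + 1 := by
      by_cases h : ic % 3 = 2
      · rw [if_pos h]
        rw [if_pos h] at hlat1 hlat2
        have hB : ((r / s - ιc - 2 : ℕ) : ℤ) = (r / s : ℕ) - ιc - 2 := by omega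
        have hB' : ((r / s - ιc + 1 : ℕ) : ℤ) = (r / s : ℕ) - ιc + 1 := by omega
        constructor
        · refine idx_le_of_mul_le (s := s) (c := 3 * e) hs0 ?_ he3
          rw [hB]
          linarith only [hlat2, hn2, hub.2.2.2, hξ2, hns']
        · refine idx_le_of_mul_le (s := s) (c := 3 * e) hs0 ?_ he3
          rw [hB']
          linarith only [hlat1, hn1, hub.2.2.1, hξ1, hns']
      · rw [if_neg h]
        rw [if_neg h] at hlat1 hlat2
        constructor
        · have : ιc ≤ ringLat r s g + 1 := by
            refine idx_le_of_mul_le (s := s) (c := e) hs0 ?_ he1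
            push_cast
            linarith only [hlat2, hub.2.2.1, hξ1]
          omega
        · refine idx_le_of_mul_le (s := s) (c := e) hs0 ?_ he1
          push_cast
          linarith only [hlat1, hub.2.2.2, hξ2]
    have hwin := piecePos_mem_window (n := r / s) (i := ic) (ι := ringLat r s g) (ιc := ιc) hιlt h2 hιn hrange
    omega
  · -- another side: the sectors
    have hmem : triRotIsoPow ic u ∈ sectorNear ic lamS := (rot_mem_sectorNear_iff hic).2 ⟨hu1, hu2⟩
    exact Set.disjoint_left.1 (disjoint_sectorNear hsd6 hic hside (by linarith)) hsecT hmem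

/-! ### A reflected ring tube off the window misses the approach strip -/

/-- **A reflected ring tube off the window of the side `3` misses a strip of the sector `0`.** The
ring of radius `r = n s`, its `g`-th tube reflected through the origin, `g` outside the window
`[blockOff n 3 + 2 yLo, blockOff n 3 + 2 yHi + 1]`, `yLo = latIdx s r t - 1`,
`yHi = latIdx s r (t + h) + 1`; the strip has rows `[t, t + h]` (`-r ≤ t`) and lies in
`sectorNear 0 lam₀` with `2e < lam₀`; `e < s`. [cite: Nolin2008, §4.3 Lemma 13 (arXiv 0711.4948: Lemma 12)] -/
theorem neg_ringTube_disjoint_strip {r e s n g : ℕ} {a t : ℤ} {W h : ℕ} {lam₀ : ℤ}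
    (hn : 1 ≤ n) (hns : n * s = r) (he : 2 * e ≤ r) (hg : g < 12 * n - 4) (hes : e < s) (htr : -(r : ℤ) ≤ t)
    (hout : g < blockOff n 3 + 2 * (latIdx s r t - 1) ∨ blockOff n 3 + 2 * (latIdx s r (t + h) + 1) + 1 < g)
    (hlam : 2 * (e : ℤ) < lam₀) (hsec : ∀ v ∈ triStrip a t W h, v 1 ≤ -lam₀ ∧ lam₀ ≤ v 0 + v 1)
    {v : Site 2} (hvT : -v ∈ (ringTube r e s g).box) (hvS : v ∈ triStrip a t W h) : False := by
  have hs : 1 ≤ s := by omega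
  have hr : n = r / s := by rw [← hns, Nat.mul_div_cancel _ hs]
  subst hr
  have hg' : g < 12 * (r / s) - 4 := hg
  obtain ⟨hsecT, hlat1, hlat2, -, -⟩ := ringTube_bounds hn ⟨_, hns.symm.trans (mul_comm _ _)⟩ he hg' hvT
  obtain ⟨hv1, hv01⟩ := hsec v hvS
  have hv0 : v ∈ sectorNear 0 lam₀ := by simp only [sectorNear, Set.mem_setOf_eq]; exact ⟨hv1, hv01⟩
  have hrows := (mem_triStrip.1 hvS)
  set sd := ringSide r s g with hsd
  have hsd6 : sd < 6 := ringSide_lt r s g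
  by_cases h3 : sd = 3
  · -- the side `3`: the lateral coordinate is `v₁`
    rw [h3] at hlat1 hlat2
    simp only [lat, Pi.neg_apply, neg_neg] at hlat1 hlat2
    have hpos := pos_le_of_side_lat hn hg'
    rw [← hsd, h3, piecePos_eq_of_ne (by decide)] at hpos
    have hs0 : 0 < s := hs
    have he1 : (e : ℤ) < s := by exact_mod_cast hes
    have hL1 := latIdx_spec (r := r) (s := s) hs htr
    have hh0 : (0 : ℤ) ≤ h := by positivity
    have hL2 := latIdx_spec (r := r) (s := s) hs (show -(r : ℤ) ≤ t + h by linarith)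
    have hlo : latIdx s r t ≤ ringLat r s g + 1 := by
      refine idx_le_of_mul_le (s := s) (c := e) hs0 ?_ he1
      push_cast
      linarith only [hL1.1, hrows.2.2.1, hlat2]
    have hhi : ringLat r s g ≤ latIdx s r (t + h) + 1 := by
      refine idx_le_of_mul_le (s := s) (c := e) hs0 ?_ he1
      push_cast
      linarith only [hL2.2, hrows.2.2.2, hlat1]
    omega
  · -- another side: the sectors
    rcases Nat.lt_or_ge sd 3 with hlt | hge
    · have hv' : v ∈ sectorNear (sd + 3) (-(2 * (e : ℤ))) := (neg_mem_sectorNear_iff hlt).1 hsecT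
      exact Set.disjoint_left.1 (disjoint_sectorNear (by omega) (by norm_num) (by omega) (by linarith)) hv' hv0
    · obtain ⟨d, hd⟩ : ∃ d, sd = d + 3 := ⟨sd - 3, by omega⟩
      have hd3 : d < 3 := by omega
      have hd0 : d ≠ 0 := by omega
      rw [hd] at hsecT
      have hv' : v ∈ sectorNear d (-(2 * (e : ℤ))) := by
        have := (neg_mem_sectorNear_iff (v := -v) hd3).2 hsecT
        rwa [neg_neg] at this
      exact Set.disjoint_left.1 (disjoint_sectorNear (by omega) (by norm_num) hd0 (by linarith)) hv' hv0

/-! ### Norms -/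

/-- **Norm of a point of the near set**: between `2M + 1` and `2M + k + L` (`-2M ≤ T₀`, `T₀ + w + 2k ≤ 0`). [folklore] -/
theorem norm_of_mem_enearSet {i M k : ℕ} {T₀ : ℤ} {w w' L ε : ℕ} (hi : i < 6) (hw : 1 ≤ w) (hL : k + 1 ≤ L) (hww : w ≤ w')
    (hfit : (w' : ℤ) + (k / 4 : ℕ) + 2 * ε ≤ k) (hlo : -(2 * (M : ℤ)) ≤ T₀) (hhi : T₀ + w + 2 * k ≤ 0) {v : Site 2}
    (hv : v ∈ enearSet i M k T₀ w w' L ε) : 2 * (M : ℤ) + 1 ≤ triNorm v ∧ triNorm v ≤ 2 * (M : ℤ) + k + L := by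
  obtain ⟨u, rfl, h1, h2, h3, h4⟩ := exists_of_mem_enearSet hw hL hww hfit hv
  have _ := hi
  rw [norm_rot_eq i (M := M) h1 (by omega) (by omega)]
  exact ⟨h1, h2⟩

/-- The reflected near set has the same norms. [folklore] -/
theorem norm_of_neg_mem_enearSet {i M k : ℕ} {T₀ : ℤ} {w w' L ε : ℕ} (hi : i < 6) (hw : 1 ≤ w) (hL : k + 1 ≤ L) (hww : w ≤ w')
    (hfit : (w' : ℤ) + (k / 4 : ℕ) + 2 * ε ≤ k) (hlo : -(2 * (M : ℤ)) ≤ T₀) (hhi : T₀ + w + 2 * k ≤ 0) {v : Site 2}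
    (hv : -v ∈ enearSet i M k T₀ w w' L ε) : 2 * (M : ℤ) + 1 ≤ triNorm v ∧ triNorm v ≤ 2 * (M : ℤ) + k + L := by
  have := norm_of_mem_enearSet hi hw hL hww hfit hlo hhi hv
  rwa [triNorm_neg] at this

/-- Norm and sign of a strip of the right half plane: `a ≤ v₀ ≤ triNorm v` (`1 ≤ a`… any `a`). [folklore] -/
theorem le_norm_of_mem_triStrip {a b : ℤ} {W h : ℕ} {v : Site 2} (hv : v ∈ triStrip a b W h) : a ≤ v 0 ∧ v 0 ≤ triNorm v := by
  rw [mem_triStrip] at hv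
  exact ⟨hv.1, le_triNorm_iff_lin.2 (Or.inl le_rfl)⟩

end Literature.Probability.Percolation
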